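import Summits.BirchSwinnertonDyer.Rank1Residual.Additive.KatoDescentKMCImpReadingRowRealizable
import Literature.NumberTheory.EllipticCurves.AnalyticRankModularityProofs
import HarnessLib

set_option autoImplicit false

/-!
# Crux 19945 `EllipticUnitValueSevenOfGZK` BY NAME with NO Cassels input: 𝒞₇ is a union of `ℚ`-isogeny classes, so the
# Kato–Perrin-Riou line proves `BSD(V, 7)` at EVERY globally minimal `V` isogenous to a member — the `bsdRHS_eq_of_isIsogenous`-free
# (and, keyed to modularity, `hasEntireLFunction_rat`-free) composition heads for a v7 `kato_perrin_riou_zp` skeleton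
# (seat `bsd-cm-prr-ty1` g18, cell `bsd-cm`; theorems only: no definition, no named fact, no instance, no `sorry`; this file
# registers nothing — the planner touches the skeleton)

Part 56 of the seat's kernel cut (crux stmt-BirchSwinnertonDyer-19945, registered line `kato_perrin_riou_zp` v6, planner D709;
stmt-BirchSwinnertonDyer-19223's istar line has no Cassels input and is untouched).

LEAF AUDIT (v6 zp head = Part 55 ★ `valueSevenOfGZK_of_rowCountOfGZK_of_rowRealizableOfGZK_of_kmcFineContra_of_perrinRiouRatio`).
The PRINT stub 6 `stub_printFactsModularityCassels : hasEntireLFunction_rat ∧ bsdRHS_eq_of_isIsogenous` feeds two binders: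
* `hCassels : bsdRHS_eq_of_isIsogenous` (Cassels 1965 / Milne ADT I.7.3: isogeny invariance of the BSD quotient — an unproved named
  Literature fact) is consumed at exactly ONE pin: `RubinFormulaZpBsdp.ramifiedCMBottomClassIndexLawAtZp_of_bsdp` →
  `ramifiedCMEllipticUnitIndexAt_of_bsdp` → `Wuthrich2014.bsdp_of_isIsogenous hCassels …`, i.e. ONLY to transport `BSD(·, p)` from the
  row member `W` to every globally minimal `V` that is `ℚ`-isogenous to `W` — the (R-EU) index law `RamifiedCMEllipticUnitIndexAt W p`
  quantifies over O11 frames, which are isogenous twins (`isIsogenous_of_isFrame`; seam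
  `ellipticUnitIndexAt_of_strictControlAt_of_bsdp_isogenyClass`).
* `hmod : hasEntireLFunction_rat` is GENUINE at one pin (Part 50 §1: `leadingLCoeff_ne_zero_holds (hmod W)` for `L′(W,1) ≠ 0`) but is a
  COROLLARY of the cite stub's own second conjunct `ModularForms.exists_isNewformOf` (`hasEntireLFunction_rat_of_exists_isNewformOf`,
  Diamond–Shurman Thm. 8.8.3).

REPLACEMENT (tree theorems only).  §0 ★ `X12.ClassCSeven.of_isIsogenous` — **𝒞₇ is a union of `ℚ`-isogeny classes** (of globally
minimal models): CM (`X12.hasCM_of_isIsogenous`, *AEC* III.6/III.9), the CM field `d_K = −7` (`X12.cmFieldDiscrOfJ_eq_of_isIsogenous`,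
Mazur's reducibility criterion at the odd ramified primes + Deuring at a Dirichlet prime), the analytic rank (`analyticRank_eq_of_isIsogenous'`,
Faltings: `L(V,s) = L(W,s)`), good ORDINARY reduction at `2` (`IsIsogenous.hasGoodReductionAtPrime_iff` *AEC* VII.7.2 +
`IsIsogenous.not_dvd_frobeniusTrace_iff`, `a₂(V) = a₂(W)`) and «every bad `q ≠ 7` split in `K`» (`X12.cmSplit_iff_of_isIsogenous`) are all
constant on the class.  Hence the line's OWN per-member descent (Part 50 §1 `rankOne_bsdp_of_countAt`, fed by the row count reading, the row
realisation, the `→`-reading and the two research stubs AT `V ∈ 𝒞₇`) gives `BSD(V, 7)` on the whole isogeny class of `W` (§2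
`bsdpSeven_of_isIsogenous_of_rowCount_of_rowRealizable_of_perrinRiou`), and §1 ★ `ramifiedCMBottomClassIndexLawAtZp_of_bsdp_isogenyClass (hGZK) (hB)`
— the Cassels-free, modularity-free twin of k7r-c3's `RubinFormulaZpBsdp.ramifiedCMBottomClassIndexLawAtZp_of_bsdp`:
`O11.ramifiedCMBottomClassIndexLawAtZp_of_indexAt (ellipticUnitIndexAt_of_strictControlAt_of_bsdp_isogenyClass (ramifiedCMStrictControlAt_holds W p) hB)
(ramifiedCMStrictTorsionAt_of_GZK hGZK W p)` — concludes the crux.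
HEADS.  §2 `valueSevenOfGZK_of_rowCount_of_rowRealizable_of_perrinRiou_isogenyClass (hC7) (hreal7) (hread) (hmod) (hKMC) (hPR)` = Part 55 §1's
K7r head with `hCassels` DROPPED (interface binders `IsOf`/`PRRatio`/`KMC`); §3 ★ `valueSevenOfGZK_of_rowCountOfGZK_of_rowRealizableOfGZK_of_kmcFineContra_of_perrinRiouRatio_isogenyClass
(hC7) (hreal7) (hmod) (hKMC) (hPR)` = the v6 composition head (Part 55 ★) with `hCassels` DROPPED, every other binder type BYTE-IDENTICAL;
§3 ★★ `valueSevenOfGZK_of_rowCountOfGZK_of_rowRealizableOfGZK_of_kmcFineContra_of_perrinRiouRatio_of_modularity (hC7) (hreal7) (hnf) (hKMC) (hPR)`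
= the same with `(hnf : ModularForms.exists_isNewformOf)` in place of `hmod` — so a v7 skeleton can read
`EllipticUnitValueSevenOfGZK_of := <§3 ★★> rowCount_closed realizable_closed stub_printFactsKato.2 (stub 2) (stub 1)` with THREE stubs
(`stub_perrinRiouRatioSeven`, `stub_katoMainConjectureFineSeven` RESEARCH; `stub_printFactsKato : H2X′ ∧ exists_isNewformOf` PURE-CITE) and
stub 6 deleted: the PRINT inputs of 19945's KPR cone become {H2X′, modularity} — the same two as 19223's.
HONEST LABEL: every statement is CONDITIONAL on displayed hypotheses (the row count reading, the row realisation, GZK, modularity, KMC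
and PR^× on the rows); `bsdRHS_eq_of_isIsogenous` stays the tree's named fact, untouched — it merely leaves THIS cone; the crux is
concluded BY NAME, never restated; 19945 / 19223 stay OPEN; no stub is closed on the ledger; no summit statement is proved by this
seat; X12.CMRamifiedSeven is NOT proved; BSD is not proved for any curve.
[cite: SilvermanAEC2009, Thm. III.6.1(a), Cor. III.6.3, Cor. III.9.4, Cor. VII.7.2] [cite: Faltings1983Endlichkeit, §5 Korollar 2, (i) ⇒ (iv)]
[cite: SilvermanAdvancedTopics1994, Exercise 2.12(b) and App. A §3 (p. 483)] [cite: Mazur1978, Thm 1 (Introduction, pp. 129–130)]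
[cite: BurnsKuriharaSano2019, Thm. 7.3 and Thm. 7.6 (p. 29), Conj. 2.8 (p. 10)] [cite: Kato2004Asterisque, Conj. 12.10 (p. 224), §14.14 (p. 243)]
[cite: Miller2011LMS, §1 and Def. 1.1 (arXiv:1010.2431 p. 3)] [cite: DiamondShurman2005, Thm. 8.8.3] [cite: BreuilConradDiamondTaylor2001, Thm. A]
-/

noncomputable section

open scoped Classical NumberField

open WeierstrassCurve Literature.NumberTheory.EllipticCurves
  Literature.NumberTheory.EllipticCurves.Rank1Residual
  Literature.NumberTheory.EllipticCurves.Rank1Residual.Typed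
  Literature.NumberTheory.EllipticCurves.IwasawaAlgebra
open Summit.BirchSwinnertonDyer.Rank1Residual
open Summit.BirchSwinnertonDyer.Rank1Residual.Additive
open Summit.BirchSwinnertonDyer.Rank1Residual.X12.O11
open Summit.BirchSwinnertonDyer.BirchSwinnertonDyer.Theses.RamifiedSevenEllipticUnits
open Summit.BirchSwinnertonDyer.BirchSwinnertonDyer.Theorems
open Summit.BirchSwinnertonDyer.BirchSwinnertonDyer.Theorems.RamifiedSevenEllipticUnits

/-! ## §0 𝒞₇ is a union of `ℚ`-isogeny classes -/

namespace Summit.BirchSwinnertonDyer.Rank1Residual.X12.ClassCSeven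

/-- ★ **Class 𝒞₇ is closed under `ℚ`-isogeny** (globally minimal models): CM, the CM field `ℚ(√−7)`, analytic rank one, good
ordinary reduction at `2`, and «every bad prime `q ≠ 7` splits in `K`» are all `ℚ`-isogeny invariants.
[cite: SilvermanAEC2009, Cor. III.9.4 and Cor. VII.7.2] [cite: Faltings1983Endlichkeit, §5 Korollar 2, (i) ⇒ (iv)]
[cite: SilvermanAdvancedTopics1994, Exercise 2.12(b) and App. A §3 (p. 483)] -/
theorem of_isIsogenous {W V : WeierstrassCurve ℚ} [W.IsElliptic] [V.IsElliptic] [W.IsGloballyMinimal]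
    [V.IsGloballyMinimal] (h : IsIsogenous W V) (hW : ClassCSeven W) : ClassCSeven V := by
  obtain ⟨hCM, hd, hr, hgo, hbad⟩ := hW
  refine ⟨hasCM_of_isIsogenous h hCM, (cmFieldDiscrOfJ_eq_of_isIsogenous h hCM) ▸ hd,
    (analyticRank_eq_of_isIsogenous' h) ▸ hr,
    ⟨(h.hasGoodReductionAtPrime_iff 2).mp hgo.1, (h.not_dvd_frobeniusTrace_iff 2 hgo.1).mp hgo.2⟩,
    fun q _ hq7 hng ↦ (cmSplit_iff_of_isIsogenous h hCM q).mp
      (hbad q hq7 fun hg ↦ hng ((h.hasGoodReductionAtPrime_iff q).mp hg))⟩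

/-- **Membership in 𝒞₇ is a property of the `ℚ`-isogeny class.** [cite: SilvermanAEC2009, Cor. III.9.4 and Cor. VII.7.2]
[cite: Faltings1983Endlichkeit, §5 Korollar 2, (i) ⇒ (iv)] -/
theorem iff_of_isIsogenous {W V : WeierstrassCurve ℚ} [W.IsElliptic] [V.IsElliptic] [W.IsGloballyMinimal]
    [V.IsGloballyMinimal] (h : IsIsogenous W V) : ClassCSeven W ↔ ClassCSeven V :=
  ⟨of_isIsogenous h, of_isIsogenous h.symm_of_charZero⟩

end Summit.BirchSwinnertonDyer.Rank1Residual.X12.ClassCSeven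

namespace Summit.BirchSwinnertonDyer.Rank1Residual.Additive.KMCImpReadingPointwise

/-! ## §1 The Cassels-free seam: `BSD(·, p)` on the isogeny class of `W` ⟹ the bottom-class index law at `(W, p)` -/

section Seam

variable {W : WeierstrassCurve ℚ} [W.IsElliptic] [W.IsGloballyMinimal] {p : ℕ} [Fact p.Prime]

/-- ★ **`BSD(V, p)` for every globally minimal `V` that is `ℚ`-isogenous to `W` ⟹ `RamifiedCMBottomClassIndexLawAtZp W p`**, granted
GZK only (for (R-tors) `ramifiedCMStrictTorsionAt_of_GZK`); (R-ctrl) is the theorem `ramifiedCMStrictControlAt_holds`, (R-EU) follows by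
`ellipticUnitIndexAt_of_strictControlAt_of_bsdp_isogenyClass`, and the converse seam `O11.ramifiedCMBottomClassIndexLawAtZp_of_indexAt`
closes.  The twin of `RubinFormulaZpBsdp.ramifiedCMBottomClassIndexLawAtZp_of_bsdp` WITHOUT Cassels (`bsdRHS_eq_of_isIsogenous`) and
WITHOUT modularity: those served there only to spread `BSD(W, p)` over the isogeny class (`Wuthrich2014.bsdp_of_isIsogenous`), which is
the hypothesis here.  Vacuous unless `W` has CM with `d_K = −p`.  CONDITIONAL. [cite: Miller2011LMS, §1 and Def. 1.1 (arXiv:1010.2431 p. 3)]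
[cite: GreenbergLNM1716, §3 Thm. 1.2 and §4 Lemma 4.2 (p. 102)] -/
theorem ramifiedCMBottomClassIndexLawAtZp_of_bsdp_isogenyClass
    (hGZK : rank_eq_analyticRank_of_analyticRank_le_one)
    (hB : ∀ (V : WeierstrassCurve ℚ) [V.IsElliptic] [V.IsGloballyMinimal], IsIsogenous W V → BSDp V p) :
    RamifiedCMBottomClassIndexLawAtZp W p :=
  ramifiedCMBottomClassIndexLawAtZp_of_indexAt
    (ellipticUnitIndexAt_of_strictControlAt_of_bsdp_isogenyClass (ramifiedCMStrictControlAt_holds W p) hB)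
    (ramifiedCMStrictTorsionAt_of_GZK hGZK W p)

end Seam

/-! ## §2 Over the interface binders: `BSD(·, 7)` on the isogeny class of a member, and crux 19945 BY NAME without Cassels -/

section RowKeyed

variable {IsOf : ∀ (W : WeierstrassCurve ℚ) [W.IsElliptic] [W.IsGloballyMinimal] (p : ℕ) [Fact p.Prime],
  KatoDescentDatum p → Prop}
variable {PRRatio : ∀ (W : WeierstrassCurve ℚ) [W.IsElliptic] [W.IsGloballyMinimal] (p : ℕ)
  [Fact p.Prime], ℚ_[p] → Prop}
variable {KMC : ∀ (W : WeierstrassCurve ℚ) [W.IsElliptic] [W.IsGloballyMinimal] (p : ℕ), Prop}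

/-- **`BSD(V, 7)` at every globally minimal `V` `ℚ`-isogenous to a member `W ∈ 𝒞₇`**, from the row count reading `hC7`, the row
realisation `hreal7`, the `→`-reading `hread`, GZK, modularity, KMC(T₇·) and PR^×(·, 7) on 𝒞₇ — Part 50 §1 `rankOne_bsdp_of_countAt`
applied AT `V`, which is again a member (`X12.ClassCSeven.of_isIsogenous`).  CONDITIONAL; nothing booked.
[cite: BurnsKuriharaSano2019, Thm. 7.6 (p. 29)] [cite: Kato2004Asterisque, Conj. 12.10 (p. 224), §14.14 (p. 243)] -/
theorem bsdpSeven_of_isIsogenous_of_rowCount_of_rowRealizable_of_perrinRiou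
    (hC7 : ∀ (W : WeierstrassCurve ℚ) [W.IsElliptic] [W.IsGloballyMinimal] [Fact (Nat.Prime 7)],
      X12.ClassCSeven W →
      ∀ (D : KatoDescentDatum 7) (ℒ : ℚ_[7]), IsOf W 7 D → PRRatio W 7 ℒ →
        Finite (coinvariants 7 D.H2) ∧ (ℒ ≠ 0 ↔ D.zetaIndex ≠ 0) ∧
          ∀ m : ℕ, D.zetaIndex = 7 ^ m * D.h2Card →
            ℒ.valuation = (m : ℤ) +
              padicValNat 7 (Nat.card (AddCommGroup.primaryComponent W.sha 7)) +
              padicValNat 7 W.tamagawaProduct)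
    (hreal7 : ∀ (W : WeierstrassCurve ℚ) [W.IsElliptic] [W.IsGloballyMinimal] [Fact (Nat.Prime 7)],
      X12.ClassCSeven W → KMC W 7 → ∃ D : KatoDescentDatum 7, IsOf W 7 D)
    (hread : ∀ (W : WeierstrassCurve ℚ) [W.IsElliptic] [W.IsGloballyMinimal] (p : ℕ) [Fact p.Prime]
      (D : KatoDescentDatum p), IsOf W p D → KMC W p → D.Conj1210)
    (hGZK : rank_eq_analyticRank_of_analyticRank_le_one) (hmod : hasEntireLFunction_rat)
    (hKMC : ∀ (W : WeierstrassCurve ℚ) [W.IsElliptic] [W.IsGloballyMinimal] [Fact (Nat.Prime 7)],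
      X12.ClassCSeven W → KMC W 7)
    (hPR : ∀ (W : WeierstrassCurve ℚ) [W.IsElliptic] [W.IsGloballyMinimal] [Fact (Nat.Prime 7)],
      X12.ClassCSeven W → PerrinRiouUpToUnitAt PRRatio W 7)
    {W : WeierstrassCurve ℚ} [W.IsElliptic] [W.IsGloballyMinimal] [Fact (Nat.Prime 7)]
    (h7 : X12.ClassCSeven W) (V : WeierstrassCurve ℚ) [V.IsElliptic] [V.IsGloballyMinimal]
    (hiso : IsIsogenous W V) : BSDp V 7 :=
  have h7V : X12.ClassCSeven V := h7.of_isIsogenous hiso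
  rankOne_bsdp_of_countAt V 7 (hC7 V h7V) (fun hK ↦ hreal7 V h7V hK) hread hGZK hmod h7V.2.2.1
    (ValueOfKMCPerrinRiou.not_seven_dvd_torsionOrder V h7V) (hPR V h7V) (hKMC V h7V)

/-- **Crux 19945 `EllipticUnitValueSevenOfGZK` ⟸ KMC(T₇W) ∧ PR^×(W, 7) on 𝒞₇, count AND realisation keyed TO THE ROWS — NO Cassels**:
Part 55 §1 `valueSevenOfGZK_of_rowCount_of_rowRealizable_of_perrinRiou` with the binder `hCassels : bsdRHS_eq_of_isIsogenous` DROPPED,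
every other binder type identical.  Per member `W`: `BSD(V, 7)` on the isogeny class of `W` (previous theorem), then the Cassels-free
seam `ramifiedCMBottomClassIndexLawAtZp_of_bsdp_isogenyClass`.  The crux is concluded BY NAME.  CONDITIONAL; 19945 stays OPEN.
[cite: BurnsKuriharaSano2019, Thm. 7.6 (p. 29)] [cite: Kato2004Asterisque, Conj. 12.10 (p. 224), §15] [cite: Miller2011LMS, §1 and Def. 1.1] -/
theorem valueSevenOfGZK_of_rowCount_of_rowRealizable_of_perrinRiou_isogenyClass
    (hC7 : ∀ (W : WeierstrassCurve ℚ) [W.IsElliptic] [W.IsGloballyMinimal] [Fact (Nat.Prime 7)],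
      X12.ClassCSeven W →
      ∀ (D : KatoDescentDatum 7) (ℒ : ℚ_[7]), IsOf W 7 D → PRRatio W 7 ℒ →
        Finite (coinvariants 7 D.H2) ∧ (ℒ ≠ 0 ↔ D.zetaIndex ≠ 0) ∧
          ∀ m : ℕ, D.zetaIndex = 7 ^ m * D.h2Card →
            ℒ.valuation = (m : ℤ) +
              padicValNat 7 (Nat.card (AddCommGroup.primaryComponent W.sha 7)) +
              padicValNat 7 W.tamagawaProduct)
    (hreal7 : ∀ (W : WeierstrassCurve ℚ) [W.IsElliptic] [W.IsGloballyMinimal] [Fact (Nat.Prime 7)],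
      X12.ClassCSeven W → KMC W 7 → ∃ D : KatoDescentDatum 7, IsOf W 7 D)
    (hread : ∀ (W : WeierstrassCurve ℚ) [W.IsElliptic] [W.IsGloballyMinimal] (p : ℕ) [Fact p.Prime]
      (D : KatoDescentDatum p), IsOf W p D → KMC W p → D.Conj1210)
    (hmod : hasEntireLFunction_rat)
    (hKMC : ∀ (W : WeierstrassCurve ℚ) [W.IsElliptic] [W.IsGloballyMinimal] [Fact (Nat.Prime 7)],
      X12.ClassCSeven W → KMC W 7)
    (hPR : ∀ (W : WeierstrassCurve ℚ) [W.IsElliptic] [W.IsGloballyMinimal] [Fact (Nat.Prime 7)],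
      X12.ClassCSeven W → PerrinRiouUpToUnitAt PRRatio W 7) :
    EllipticUnitValueSevenOfGZK :=
  fun hGZK _ _ _ _ h7 ↦
    ramifiedCMBottomClassIndexLawAtZp_of_bsdp_isogenyClass hGZK fun V _ _ hiso ↦
      bsdpSeven_of_isIsogenous_of_rowCount_of_rowRealizable_of_perrinRiou hC7 hreal7 hread hGZK hmod
        hKMC hPR h7 V hiso

end RowKeyed

/-! ## §3 At the PRINT-EXACT closed triple, GZK-guarded: the Cassels-free v7 composition heads -/

section Closed

/-- ★ **Crux 19945 BY NAME from a ROW-KEYED stub 3 and a ROW-KEYED stub 4, both GUARDED BY GZK, with NO Cassels input** — Part 55 ★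
`valueSevenOfGZK_of_rowCountOfGZK_of_rowRealizableOfGZK_of_kmcFineContra_of_perrinRiouRatio` with `hCassels` DROPPED; `hC7`, `hreal7`,
`hmod`, `hKMC`, `hPR` BYTE-IDENTICAL; the `→`-only reading discharged by
`conj1210_of_isKatoZetaDescentDatumOfContra_of_katoMainConjectureFineContra` (p628155); GZK is the crux's own antecedent.  CONDITIONAL;
19945 stays OPEN; BSD is not proved. [cite: BurnsKuriharaSano2019, Thm. 7.6 (p. 29), Conj. 2.8 (ii) (p. 10)]
[cite: Kato2004Asterisque, Conj. 12.10 (p. 224), §14.14 (p. 243)] [cite: Miller2011LMS, §1 and Def. 1.1] -/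
theorem valueSevenOfGZK_of_rowCountOfGZK_of_rowRealizableOfGZK_of_kmcFineContra_of_perrinRiouRatio_isogenyClass
    (hC7 : rank_eq_analyticRank_of_analyticRank_le_one →
      ∀ (W : WeierstrassCurve ℚ) [W.IsElliptic] [W.IsGloballyMinimal] [Fact (Nat.Prime 7)],
      X12.ClassCSeven W →
      ∀ (D : KatoDescentDatum 7) (ℒ : ℚ_[7]),
        IsKatoZetaDescentDatumOfContra W 7 D → Kato2004.PRRatio W 7 ℒ →
        Finite (coinvariants 7 D.H2) ∧ (ℒ ≠ 0 ↔ D.zetaIndex ≠ 0) ∧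
          ∀ m : ℕ, D.zetaIndex = 7 ^ m * D.h2Card →
            ℒ.valuation = (m : ℤ) +
              padicValNat 7 (Nat.card (AddCommGroup.primaryComponent W.sha 7)) +
              padicValNat 7 W.tamagawaProduct)
    (hreal7 : rank_eq_analyticRank_of_analyticRank_le_one →
      ∀ (W : WeierstrassCurve ℚ) [W.IsElliptic] [W.IsGloballyMinimal] [Fact (Nat.Prime 7)],
      X12.ClassCSeven W →
      KatoMainConjectureFineContra W 7 → ∃ D : KatoDescentDatum 7, IsKatoZetaDescentDatumOfContra W 7 D)
    (hmod : hasEntireLFunction_rat)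
    (hKMC : ∀ (W : WeierstrassCurve ℚ) [W.IsElliptic] [W.IsGloballyMinimal] [Fact (Nat.Prime 7)],
      X12.ClassCSeven W → KatoMainConjectureFineContra W 7)
    (hPR : ∀ (W : WeierstrassCurve ℚ) [W.IsElliptic] [W.IsGloballyMinimal] [Fact (Nat.Prime 7)],
      X12.ClassCSeven W → PerrinRiouUpToUnitAt Kato2004.PRRatio W 7) :
    EllipticUnitValueSevenOfGZK :=
  fun hGZK ↦ valueSevenOfGZK_of_rowCount_of_rowRealizable_of_perrinRiou_isogenyClass (hC7 hGZK) (hreal7 hGZK)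
    (fun _ _ _ _ _ _ hD hK ↦ conj1210_of_isKatoZetaDescentDatumOfContra_of_katoMainConjectureFineContra hD hK)
    hmod hKMC hPR hGZK

/-- ★★ **The same head KEYED TO MODULARITY** — `(hnf : ModularForms.exists_isNewformOf)` (the second conjunct of the v6 cite stub
`stub_printFactsKato`) in place of `hmod : hasEntireLFunction_rat`, which it implies (`hasEntireLFunction_rat_of_exists_isNewformOf`,
Diamond–Shurman Thm. 8.8.3).  Intended as the composition term of a v7 zp skeleton with THREE stubs:
`EllipticUnitValueSevenOfGZK_of := <this> rowCount_closed realizable_closed stub_printFactsKato.2 (stub 2) (stub 1)` (the planner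
registers; this file registers nothing).  CONDITIONAL; 19945 stays OPEN; BSD is not proved.
[cite: DiamondShurman2005, Thm. 8.8.3] [cite: BreuilConradDiamondTaylor2001, Thm. A] [cite: BurnsKuriharaSano2019, Thm. 7.6 (p. 29), Conj. 2.8 (ii) (p. 10)]
[cite: Kato2004Asterisque, Conj. 12.10 (p. 224), §14.14 (p. 243)] -/
theorem valueSevenOfGZK_of_rowCountOfGZK_of_rowRealizableOfGZK_of_kmcFineContra_of_perrinRiouRatio_of_modularity
    (hC7 : rank_eq_analyticRank_of_analyticRank_le_one →
      ∀ (W : WeierstrassCurve ℚ) [W.IsElliptic] [W.IsGloballyMinimal] [Fact (Nat.Prime 7)],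
      X12.ClassCSeven W →
      ∀ (D : KatoDescentDatum 7) (ℒ : ℚ_[7]),
        IsKatoZetaDescentDatumOfContra W 7 D → Kato2004.PRRatio W 7 ℒ →
        Finite (coinvariants 7 D.H2) ∧ (ℒ ≠ 0 ↔ D.zetaIndex ≠ 0) ∧
          ∀ m : ℕ, D.zetaIndex = 7 ^ m * D.h2Card →
            ℒ.valuation = (m : ℤ) +
              padicValNat 7 (Nat.card (AddCommGroup.primaryComponent W.sha 7)) +
              padicValNat 7 W.tamagawaProduct)
    (hreal7 : rank_eq_analyticRank_of_analyticRank_le_one →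
      ∀ (W : WeierstrassCurve ℚ) [W.IsElliptic] [W.IsGloballyMinimal] [Fact (Nat.Prime 7)],
      X12.ClassCSeven W →
      KatoMainConjectureFineContra W 7 → ∃ D : KatoDescentDatum 7, IsKatoZetaDescentDatumOfContra W 7 D)
    (hnf : ModularForms.exists_isNewformOf)
    (hKMC : ∀ (W : WeierstrassCurve ℚ) [W.IsElliptic] [W.IsGloballyMinimal] [Fact (Nat.Prime 7)],
      X12.ClassCSeven W → KatoMainConjectureFineContra W 7)
    (hPR : ∀ (W : WeierstrassCurve ℚ) [W.IsElliptic] [W.IsGloballyMinimal] [Fact (Nat.Prime 7)],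
      X12.ClassCSeven W → PerrinRiouUpToUnitAt Kato2004.PRRatio W 7) :
    EllipticUnitValueSevenOfGZK :=
  valueSevenOfGZK_of_rowCountOfGZK_of_rowRealizableOfGZK_of_kmcFineContra_of_perrinRiouRatio_isogenyClass
    hC7 hreal7 (hasEntireLFunction_rat_of_exists_isNewformOf hnf) hKMC hPR

end Closed

end Summit.BirchSwinnertonDyer.Rank1Residual.Additive.KMCImpReadingPointwise

end
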